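import Mathlib
import HarnessLib
import Summits.AtomisticToContinuum.FouriersLaw.Theses.JunctionLocality
import Summits.AtomisticToContinuum.FouriersLaw.Theorems.JunctionLocalitySuperadditiveResistanceDeviceLiouville
import Summits.AtomisticToContinuum.FouriersLaw.Theorems.JunctionLocalitySuperadditiveResistancePlainAdjoint
import Summits.AtomisticToContinuum.FouriersLaw.Theorems.JunctionLocalitySuperadditiveResistanceKuboKernel
import Summits.AtomisticToContinuum.FouriersLaw.Theorems.JunctionLocalitySuperadditiveResistanceStubDeviceForwardFieldsAux5
import Summits.AtomisticToContinuum.FouriersLaw.Theorems.JunctionLocalitySuperadditiveResistanceStubPlainForwardField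

/-!
# Relocated forward fields at the two anchor placements `m = L − 1` and `m = 0`
(helpers `relocForwardField_end`, `relocForwardField_anchor` toward stub `stub_relocForwardField` of line
`cold-bath-relocation-walk`, crux stmt-AtomisticToContinuum-11749 `JunctionLocality.ConductanceLowerBound`;
`--supports` stmt-AtomisticToContinuum-11749)

The line keeps ONE `L`-site Hamiltonian `H` of `pinnedChain ω₂ lam β γ` and its Gibbs state `μ_T`, puts the hot
thermostat on site `0` and the COLD thermostat on site `m`, all at temperature `T`:
`L_m g = X_H g + γ (S_0 g + S_m g)` with `X_H = liouvilleOp`, `S_s = thermo L s T = T∂²_{p_s} − p_s∂_{p_s}`.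
A relocated forward field is a classical mean-zero `C² ∩ L²(μ_T)` solution of `L_m g = −(p_0² − T)`; the stub
`stub_relocForwardField` asks for one at every `m < L`.  This file settles the two placements that need no new
ergodic input:

* `relocForwardField_end` (`m = L − 1`, `L ≥ 2`): `S_0 + S_{L−1} = S_{bathWeight}` (`bathOp_bathWeight_eq_thermo`),
  so `L_{L−1}` is the plain equilibrium generator `L_{T,T}` (`generator_eq_liouvilleOp_add`) and the field is the
  LANDED plain forward field `stub_plainForwardField` (CEHR 2018 Thm 2.13 + Hörmander, sorry-free in the tree).
* `relocForwardField_anchor` (`m = 0`, `L ≥ 1`): both thermostats sit on site `0`, `L_0 = X_H + 2γ S_0`, and the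
  field is EXPLICIT, `g = (H − ⟨H⟩_{μ_T})/(2γ)`: `X_H H = 0` (`liouvilleOp_hamiltonian`) and
  `S_0 H = T − p_0²` (`∂_{p_0} H = p_0`, `∂²_{p_0} H = 1`), so `L_0 g = (2γ/(2γ))(T − p_0²) = −(p_0² − T)`;
  `H ∈ L²(μ_T)` is `memLp_hamiltonian`.

Interior placements `1 ≤ m ≤ L − 2` are NOT here: they need a `λ`-uniform `L²(μ_T)` bound on the resolvent fields
`(λ − L_m)⁻¹(p_0² − T)` (quantitative ergodicity of the equilibrium Langevin network with baths on `{0, m}`,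
Cuneo–Eckmann–Hairer–Rey-Bellet 2018 Thm 2.13(3) in network form), see the companion reduction
`…RelocForwardFieldOfResolventBound`.  No definitions; standard axioms.
-/

noncomputable section

open MeasureTheory Filter Topology
open scoped ContDiff
open Literature.MathematicalPhysics.KineticTheory.HeatConduction
open Summit.AtomisticToContinuum.FouriersLaw.Theorems.SuperadditiveResistance.DeviceLiouville
  (kin thermo liouvilleOp bathOp kin_eq_sq thermo_eq generator_eq_liouvilleOp_add)
open Summit.AtomisticToContinuum.FouriersLaw.Theorems.SuperadditiveResistance.Kubo
  (liouvilleOp_hamiltonian partialP_partialP_hamiltonian memLp_hamiltonian)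
open Summit.AtomisticToContinuum.FouriersLaw.Cruxes.SuperadditiveResistance.FloatingProbeBypassLaplacian
  (stub_plainForwardField partialP_sub_const' partialQ_sub_const' liouvilleOp_const_mul)

namespace Summit.AtomisticToContinuum.FouriersLaw.Cruxes.ConductanceLowerBound.ColdBathRelocationWalk

/-! ## Thermostat bookkeeping: weighted baths versus single-site thermostats -/

section Bridge

variable {L : ℕ}

/-- The plain chain's weighted bath operator is the sum of the two end thermostats:
`S_{bathWeight} = S_0 + S_{L−1}` (as `thermo L 0 T + thermo L (L − 1) T`; on a one-site chain both act on
site `0`). [folklore] -/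
theorem bathOp_bathWeight_eq_thermo (L : ℕ) (T : ℝ) (g : PhaseSpace L → ℝ) (x : PhaseSpace L) :
    bathOp L (OscillatorChain.bathWeight L) T g x = thermo L 0 T g x + thermo L (L - 1) T g x := by
  -- adapted from the line skeleton's `bathOp_relocWeight`
  unfold bathOp thermo OscillatorChain.bathWeight
  rw [← Finset.sum_add_distrib]
  refine Finset.sum_congr rfl fun i _ => ?_
  split_ifs <;> ring

/-- `X_H` annihilates constants: `X_H (f − c) = X_H f`. [folklore] -/
theorem liouvilleOp_sub_const (P : OscillatorChain) (f : PhaseSpace L → ℝ) (c : ℝ) (x : PhaseSpace L) :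
    liouvilleOp P L (fun y => f y - c) x = liouvilleOp P L f x := by
  simp only [liouvilleOp, partialP_sub_const', partialQ_sub_const']

/-- A single-site thermostat annihilates constants: `S_s (f − c) = S_s f`. [folklore] -/
theorem thermo_sub_const (s : ℕ) (θ : ℝ) (f : PhaseSpace L → ℝ) (c : ℝ) (x : PhaseSpace L) :
    thermo L s θ (fun y => f y - c) x = thermo L s θ f x := by
  simp only [thermo, partialP_sub_const']

/-- A single-site thermostat is homogeneous: `S_s (a f) = a S_s f`. [folklore] -/
theorem thermo_const_mul (s : ℕ) (θ a : ℝ) (f : PhaseSpace L → ℝ) (x : PhaseSpace L) :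
    thermo L s θ (fun y => a * f y) x = a * thermo L s θ f x := by
  unfold thermo
  rw [Finset.mul_sum]
  refine Finset.sum_congr rfl fun i _ => ?_
  have h1 : partialP i (fun y => a * f y) = fun y => a * partialP i f y :=
    funext fun y => partialP_const_mul a f i y
  rw [h1, partialP_const_mul]
  split_ifs <;> ring

/-- The thermostat of site `s` pumps `T − p_s²` into the energy: `S_s H = T − p_s²` (`∂_{p_s} H = p_s`,
`∂²_{p_s} H = 1`). [folklore] -/
theorem thermo_hamiltonian (P : OscillatorChain) {s : ℕ} (hs : s < L) (T : ℝ) (x : PhaseSpace L) :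
    thermo L s T (P.hamiltonian L) x = T - x.2 ⟨s, hs⟩ ^ 2 := by
  rw [thermo_eq hs, partialP_partialP_hamiltonian, P.partialP_hamiltonian]
  ring

end Bridge

/-! ## The two anchor placements -/

/-- **Relocated forward field at the END placement `m = L − 1` (`L ≥ 2`).** For `pinnedChain ω₂ lam β γ`
(all parameters `> 0`), `T > 0`: there is a classical mean-zero `C² ∩ L²(μ_T)` solution of
`X_H g + γ (S_0 g + S_{L−1} g) = −(p_0² − T)`.  This is the plain chain's equilibrium forward field of the left
bath (`stub_plainForwardField`, landed: CEHR 2018 Thm 2.13(3) + Hörmander), read through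
`L_{T,T} = X_H + γ S_{bathWeight}` and `S_{bathWeight} = S_0 + S_{L−1}`. [folklore] -/
theorem relocForwardField_end : ∀ (ω₂ lam β γ T : ℝ), 0 < ω₂ → 0 < lam → 0 < β → 0 < γ → 0 < T → ∀ (L : ℕ), 2 ≤ L → ∃ g : PhaseSpace L → ℝ, ContDiff ℝ 2 g ∧ MemLp g 2 ((pinnedChain ω₂ lam β γ).gibbsMeasure L T) ∧ ∫ x, g x ∂((pinnedChain ω₂ lam β γ).gibbsMeasure L T) = 0 ∧ ∀ x, liouvilleOp (pinnedChain ω₂ lam β γ) L g x + γ * (thermo L 0 T g x + thermo L (L - 1) T g x) = -(kin L 0 x - T) := by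
  intro ω₂ lam β γ T hω hl hβ hγ hT L hL
  obtain ⟨g, hC, hL2, hmean, hpde⟩ := stub_plainForwardField ω₂ lam β γ T hω hl hβ hγ hT L hL
  refine ⟨g, hC, hL2, hmean, fun x => ?_⟩
  rw [← bathOp_bathWeight_eq_thermo, ← hpde x, generator_eq_liouvilleOp_add]
  rfl

/-- **Relocated forward field at the ANCHOR placement `m = 0` (`L ≥ 1`).** For `pinnedChain ω₂ lam β γ`
(all parameters `> 0`), `T > 0`: there is a classical mean-zero `C² ∩ L²(μ_T)` solution of
`X_H g + γ (S_0 g + S_0 g) = −(p_0² − T)`, namely `g = (H − ⟨H⟩_{μ_T})/(2γ)`: `X_H H = 0`, `S_0 H = T − p_0²`,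
`H ∈ L²(μ_T)`. [folklore] -/
theorem relocForwardField_anchor : ∀ (ω₂ lam β γ T : ℝ), 0 < ω₂ → 0 < lam → 0 < β → 0 < γ → 0 < T → ∀ (L : ℕ), 0 < L → ∃ g : PhaseSpace L → ℝ, ContDiff ℝ 2 g ∧ MemLp g 2 ((pinnedChain ω₂ lam β γ).gibbsMeasure L T) ∧ ∫ x, g x ∂((pinnedChain ω₂ lam β γ).gibbsMeasure L T) = 0 ∧ ∀ x, liouvilleOp (pinnedChain ω₂ lam β γ) L g x + γ * (thermo L 0 T g x + thermo L 0 T g x) = -(kin L 0 x - T) := by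
  intro ω₂ lam β γ T hω hl hβ hγ hT L hL
  set P := pinnedChain ω₂ lam β γ with hP
  set μ := P.gibbsMeasure L T with hμ
  haveI : IsProbabilityMeasure μ := pinnedChain_isProbabilityMeasure_gibbsMeasure hω hl.le hβ.le γ L hT
  set H : PhaseSpace L → ℝ := P.hamiltonian L with hH
  have hHC : ContDiff ℝ 2 H :=
    P.contDiff_hamiltonian (pinnedChain_contDiff_U ω₂ lam β γ) (pinnedChain_contDiff_V ω₂ lam β γ) L
  have hHL2 : MemLp H 2 μ := memLp_hamiltonian hω hl.le hβ.le L hT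
  set c₀ : ℝ := ∫ x, H x ∂μ with hc₀
  set a : ℝ := (2 * γ)⁻¹ with ha
  refine ⟨fun y => a * (H y - c₀), ?_, ?_, ?_, fun x => ?_⟩
  · exact contDiff_const.mul (hHC.sub contDiff_const)
  · exact (hHL2.sub (memLp_const c₀)).const_mul a
  · have hHi : Integrable H μ := hHL2.integrable one_le_two
    rw [integral_const_mul, integral_sub hHi (integrable_const c₀), integral_const]
    simp [probReal_univ, hc₀]
  · have h1 : liouvilleOp P L (fun y => a * (H y - c₀)) x = 0 := by
      rw [liouvilleOp_const_mul P a (fun y => H y - c₀) x, liouvilleOp_sub_const, hH,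
        liouvilleOp_hamiltonian, mul_zero]
    have h2 : thermo L 0 T (fun y => a * (H y - c₀)) x = a * (T - x.2 ⟨0, hL⟩ ^ 2) := by
      rw [thermo_const_mul 0 T a (fun y => H y - c₀) x, thermo_sub_const, hH, thermo_hamiltonian P hL]
    rw [h1, h2, kin_eq_sq hL, ha]
    field_simp
    ring

end Summit.AtomisticToContinuum.FouriersLaw.Cruxes.ConductanceLowerBound.ColdBathRelocationWalk

end
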